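import Summits.Ventures.PercRepro.SixThreePlane
import Summits.Ventures.PercRepro.SixThreeTriple
import Summits.Ventures.PercRepro.SixThreeTripleB
import Summits.Ventures.PercRepro.SixThreeColoop

/-!
# Theorem P₁′ for C-025 at `(6, 3)`: the per-triple lemma — part A: the share lemmas (p5, gen 7)

mine-2's `MINE2-RLS.md` §19.4′ (the primal proof, every ambient rank), in the shape of p2's `hP₁`
(`SixThreePlane.perPlane_of_six_le`): `M` simple, `G` a plane, `T ⊆ G` an independent triple, `W` an independent
`6`-set outside `G`; then the witnesses `S` with `S ∩ G = T` and `S ∖ G ⊆ W` supply `Σ f(G, S) / D(S) ≥ 3`.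
Split for the ≤ 400-line lint (proofs byte-identical): this part holds the set-theoretic helpers and the structural
lemmas of §19.4′ — the closure property of a lossy pair (`mem_clF_insert_of_eRk_eq_four`), the count of repayment
points (`two_le_card_repayment`), `Λ(T ∪ X) ≤ 20` (`Lam_le_twenty`) and the repayment triple `(T)`
(`triple_witness_of_coloop`, from `SixThreeColoop`); `SixThreeP1B.lean` holds the accounting `P1_of_bounds` and
`SixThreeP1.lean` the theorem `supply_ge_three`.
-/

namespace PercRepro

namespace SixThree

namespace P1

open Finset ThmH PerFlat

variable {α : Type*} [DecidableEq α] {M : Matroid α} [M.Finite]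

/-- The share of `S` at the plane `G`. -/
noncomputable abbrev share (M : Matroid α) [M.Finite] (G S : Finset α) : ℚ := fRule M G S / D M S

/-- `S ∩ G = T` for the single-point witness. -/
theorem single_inter_eq {G T : Finset α} {x : α} (hT : T ⊆ G) (hx : x ∉ G) : (insert x T) ∩ G = T := by
  ext y
  rw [Finset.mem_inter, Finset.mem_insert]
  constructor
  · rintro ⟨rfl | hy, hyG⟩
    · exact absurd hyG hx
    · exact hy
  · intro hy
    exact ⟨Or.inr hy, hT hy⟩

/-- `S ∩ G = T` for the triple witness. -/
theorem triple_inter_eq {G T : Finset α} {x x' y : α} (hT : T ⊆ G) (hx : x ∉ G) (hx' : x' ∉ G) (hy : y ∉ G) :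
    (insert y (insert x (insert x' T))) ∩ G = T := by
  ext z
  rw [Finset.mem_inter, Finset.mem_insert, Finset.mem_insert, Finset.mem_insert]
  constructor
  · rintro ⟨rfl | rfl | rfl | hz, hzG⟩
    · exact absurd hzG hy
    · exact absurd hzG hx
    · exact absurd hzG hx'
    · exact hz
  · intro hz
    exact ⟨Or.inr (Or.inr (Or.inr hz)), hT hz⟩

/-- A witness inside `W ∪ T` has `S ∖ G ⊆ W`. -/
theorem sdiff_subset_of_subset_union {G T W S : Finset α} (hT : T ⊆ G) (hS : S ⊆ W ∪ T) :
    S \ G ⊆ W := by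
  intro z hz
  rw [Finset.mem_sdiff] at hz
  have := hS hz.1
  rw [Finset.mem_union] at this
  rcases this with h | h
  · exact h
  · exact absurd (hT h) hz.2

omit [DecidableEq α] in
/-- `clF` is monotone. -/
theorem clF_subset_clF_of_subset {A B : Finset α} (h : A ⊆ B) : clF M A ⊆ clF M B := by
  intro z hz
  have h1 : z ∈ ((clF M A : Finset α) : Set α) := hz
  rw [coe_clF] at h1
  have h2 : z ∈ M.closure (B : Set α) := M.closure_subset_closure (Finset.coe_subset.2 h) h1
  rw [← coe_clF] at h2
  exact h2

/-! ### The closure property of a lossy pair, the count of repayment points, the repayment triple -/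

omit [DecidableEq α] in
/-- A point of `B ⊆ E` lies in `clF M B`. -/
theorem mem_clF_of_mem {B : Finset α} (hB : B ⊆ gr M) {x : α} (hx : x ∈ B) : x ∈ clF M B := by
  have h : x ∈ M.closure (B : Set α) :=
    M.mem_closure_of_mem (Finset.mem_coe.2 hx) (by rw [← coe_gr M]; exact Finset.coe_subset.2 hB)
  rw [← coe_clF] at h
  exact Finset.mem_coe.1 h

/-- **The closure property of a lossy pair**: `ρ(T ∪ {x, x′}) = 4` (with `T ⊆ G` of rank `3`, `x ∉ G`) puts `x′`
in `cl(T ∪ x)`. -/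
theorem mem_clF_insert_of_eRk_eq_four {G T : Finset α} (hG : G ∈ planes M) (hT : T ⊆ G)
    (hrT : M.eRk (T : Set α) = 3) {x x' : α} (hx : x ∈ gr M) (hx' : x' ∈ gr M) (hxG : x ∉ G)
    (hr : M.eRk ((insert x (insert x' T) : Finset α) : Set α) = 4) : x' ∈ clF M (insert x T) := by
  by_contra hcon
  have hx'E : x' ∈ M.E := by rw [← coe_gr M]; exact Finset.mem_coe.2 hx'
  have hnot : x' ∉ M.closure ((insert x T : Finset α) : Set α) := by
    intro h
    apply hcon
    rw [← coe_clF] at h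
    exact Finset.mem_coe.1 h
  have h5 := M.eRk_insert_eq_add_one (X := ((insert x T : Finset α) : Set α)) ⟨hx'E, hnot⟩
  rw [eRk_insert_eq_four hG hT hrT hx hxG] at h5
  have heq : (insert x' ((insert x T : Finset α) : Set α)) =
      ((insert x (insert x' T) : Finset α) : Set α) := by
    rw [Finset.coe_insert, Finset.coe_insert, Finset.coe_insert, Set.insert_comm]
  rw [heq, hr] at h5
  exact absurd h5 (by decide)

/-- **The count of repayment points** (`6 − c ≥ 2`, mine-2 §19.4′): `W` independent with `|W| = 6` and the lossy
pair `{x, x′} ⊆ W`; at most `4` points of `W` lie in `cl(T ∪ {x, x′})` (rank `4`), so at least two points of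
`W ∖ {x, x′}` lie outside it. -/
theorem two_le_card_repayment {G T W : Finset α} (hG : G ∈ planes M) (hT : T ⊆ G) (hW : W ⊆ gr M)
    (hWi : M.Indep (W : Set α)) (hW6 : W.card = 6) {x x' : α} (hx : x ∈ W) (hx' : x' ∈ W)
    (hr : M.eRk ((insert x (insert x' T) : Finset α) : Set α) = 4) :
    2 ≤ (W.filter fun y => y ≠ x ∧ y ≠ x' ∧ y ∉ clF M (insert x (insert x' T))).card := by
  classical
  set S := insert x (insert x' T) with hS
  have hSg : S ⊆ gr M :=
    Finset.insert_subset (hW hx) (Finset.insert_subset (hW hx') (hT.trans (mem_planes.1 hG).1))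
  -- the points of `W` in the closure form an independent subset of a rank-`4` set
  have hC : (W.filter fun y => y ∈ clF M S).card ≤ 4 := by
    have hind : M.Indep ((W.filter fun y => y ∈ clF M S : Finset α) : Set α) :=
      hWi.subset (Finset.coe_subset.2 (Finset.filter_subset _ _))
    have hsub : ((W.filter fun y => y ∈ clF M S : Finset α) : Set α) ⊆ M.closure (S : Set α) := by
      intro y hy
      rw [Finset.mem_coe, Finset.mem_filter] at hy
      rw [← coe_clF]
      exact Finset.mem_coe.2 hy.2
    have h := hind.encard_le_eRk_of_subset hsub
    rw [M.eRk_closure_eq, hr, Set.encard_coe_eq_coe_finsetCard] at h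
    exact_mod_cast h
  have hsplit := Finset.card_filter_add_card_filter_not (s := W) (fun y => y ∈ clF M S)
  have hmono : W.filter (fun y => ¬ y ∈ clF M S) ⊆ W.filter fun y => y ≠ x ∧ y ≠ x' ∧ y ∉ clF M S := by
    intro y hy
    rw [Finset.mem_filter] at hy ⊢
    refine ⟨hy.1, ?_, ?_, hy.2⟩
    · rintro rfl
      exact hy.2 (mem_clF_of_mem hSg (Finset.mem_insert_self _ _))
    · rintro rfl
      exact hy.2 (mem_clF_of_mem hSg (Finset.mem_insert_of_mem (Finset.mem_insert_self _ _)))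
  have := Finset.card_le_card hmono
  omega

/-- Every line of `M|S` for a `5`-point set `S` of rank `4` meets `S` in at most `3` points (a line through `4`
of the points leaves one, and `ρ(S) ≤ 2 + 1`). -/
theorem card_inter_le_three_of_rank_four {S L : Finset α} (hS5 : S.card = 5)
    (hrS : M.eRk (S : Set α) = 4) (hL : L ∈ linesOf M S) : (L ∩ S).card ≤ 3 := by
  by_contra hcon
  push Not at hcon
  have hrL : M.eRk (L : Set α) = 2 :=
    (mem_lines.1 (Finset.mem_filter.1 hL).1).2.2
  have hsd : (S \ L).card ≤ 1 := by
    rw [Finset.card_sdiff, hS5]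
    omega
  have hcover : (S : Set α) = ((S ∩ L : Finset α) : Set α) ∪ ((S \ L : Finset α) : Set α) := by
    rw [← Finset.coe_union, Finset.union_comm, Finset.sdiff_union_inter]
  have h1 : M.eRk ((S ∩ L : Finset α) : Set α) ≤ 2 := by
    rw [← hrL]
    exact M.eRk_mono (Finset.coe_subset.2 Finset.inter_subset_right)
  have h2 : M.eRk ((S \ L : Finset α) : Set α) ≤ 1 := by
    refine (M.eRk_le_encard _).trans ?_
    rw [Set.encard_coe_eq_coe_finsetCard]
    exact_mod_cast hsd
  have h := M.eRk_union_le_eRk_add_eRk ((S ∩ L : Finset α) : Set α) ((S \ L : Finset α) : Set α)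
  rw [← hcover, hrS] at h
  have h3 : (4 : ℕ∞) ≤ 2 + 1 := h.trans (add_le_add h1 h2)
  exact absurd h3 (by decide)

/-- `Λ(S) ≤ 20` for a `5`-point set `S` of rank `4` (p2's `Lam_mul_choose_le` with `m = 3`:
`3 · Λ ≤ 6 · C(5, 2) = 60`). -/
theorem Lam_le_twenty (hs : Simple M) {S : Finset α} (hS : S ⊆ gr M) (hS5 : S.card = 5)
    (hrS : M.eRk (S : Set α) = 4) : Lam M S ≤ 20 := by
  have h := Lam_mul_choose_le hs hS (m := 3) (fun L hL => card_inter_le_three_of_rank_four hS5 hrS hL)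
  rw [hS5] at h
  norm_num [Nat.choose] at h
  linarith

/-- **The repayment triple** `(T)`, modulo the coloop lemma: for a lossy pair `{x, x′}` and `y` outside
`cl(T ∪ {x, x′})`, given `D(T ∪ {x, x′, y}) ≤ D(T ∪ {x, x′}) + Λ(T ∪ {x, x′})` (p2's
`D_insert_le_of_notMem_closure`), the triple is a witness of rank `5` with share `≥ 1/35`
(`D ≤ 15 + 20`, by p2's `D_pair_le_triple` and `Lam_le_twenty`). -/
theorem triple_witness_of_coloop (hs : Simple M) {G T : Finset α} (hG : G ∈ planes M) (hT : T ⊆ G)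
    (hrT : M.eRk (T : Set α) = 3) (hT3 : T.card = 3) {x x' y : α} (hx : x ∈ gr M) (hx' : x' ∈ gr M)
    (hy : y ∈ gr M) (hxx' : x ≠ x') (hxG : x ∉ G) (hx'G : x' ∉ G) (hyG : y ∉ G)
    (hr : M.eRk ((insert x (insert x' T) : Finset α) : Set α) = 4)
    (hycl : y ∉ clF M (insert x (insert x' T)))
    (hL4 : D M (insert y (insert x (insert x' T))) ≤
      D M (insert x (insert x' T)) + Lam M (insert x (insert x' T))) :
    M.eRk ((insert y (insert x (insert x' T)) : Finset α) : Set α) = 5 ∧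
      (1 / 35 : ℚ) ≤ share M G (insert y (insert x (insert x' T))) := by
  classical
  have hTg : T ⊆ gr M := hT.trans (mem_planes.1 hG).1
  have hxT : x ∉ T := fun h => hxG (hT h)
  have hx'T : x' ∉ T := fun h => hx'G (hT h)
  have hSg : insert x (insert x' T) ⊆ gr M :=
    Finset.insert_subset hx (Finset.insert_subset hx' hTg)
  have hS5 : (insert x (insert x' T)).card = 5 := by
    rw [Finset.card_insert_of_notMem, Finset.card_insert_of_notMem hx'T, hT3]
    rw [Finset.mem_insert]
    rintro (h | h)
    · exact hxx' h
    · exact hxT h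
  have hyE : y ∈ M.E := by rw [← coe_gr M]; exact Finset.mem_coe.2 hy
  have hnot : y ∉ M.closure ((insert x (insert x' T) : Finset α) : Set α) := by
    intro h
    apply hycl
    rw [← coe_clF] at h
    exact Finset.mem_coe.1 h
  have hr5 : M.eRk ((insert y (insert x (insert x' T)) : Finset α) : Set α) = 5 := by
    rw [Finset.coe_insert, M.eRk_insert_eq_add_one ⟨hyE, hnot⟩, hr]
    rfl
  refine ⟨hr5, ?_⟩
  have hD15 := D_pair_le_triple hs hG hT hrT hT3 hx hx' hxx' hxG hx'G
  have hLam := Lam_le_twenty hs hSg hS5 hr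
  have hSG : insert y (insert x (insert x' T)) ∩ G = T := triple_inter_eq hT hxG hx'G hyG
  obtain ⟨-, hDpos⟩ := D_pos hG hSG hrT
  show (1 / 35 : ℚ) ≤ fRule M G _ / D M _
  rw [fRule_eq_of_inter hSG hrT, hT3, le_div_iff₀ hDpos]
  norm_num
  linarith

end P1

end SixThree

end PercRepro
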